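import Summits.RiemannHypothesis.RiemannHypothesis.Theorems.PfPersistenceDownCone
import Summits.RiemannHypothesis.RiemannHypothesis.Theorems.PfPersistenceF5TailTwins
import HarnessLib

/-!
# PF persistence, fake seat 4 — THEOREM F4-B±: the CONE TAIL BOUND (down- and up-cone twins)

Unit `pub-rhpf-fake-4` (gen 2) of the `pub-rhpf` cell — mechanism / rigidity campaign; **no RH claims**.

This generalises fake-5's THEOREM F5-A (`PfPersistenceF5TailTwins.tailDialRayleighBound`: ONE
prime dialled) to ARBITRARY real weight tables `w'` in the down-cone or the up-cone of `ζ`'s table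
`w_ζ(n) = Λ(n)/√n` on a window — random-multiplicative-function sign corners (many flipped `n`),
deletion SETS, several `F₋`/`F₊` dials at once.  Fix `0 < b`, a point `n₀` with
`L := log n₀ > 2b`, the window `a := L/2 + b`, and a REAL ONE-SIGNED Weil test `g₁` supported in
`[-b, b]` with `Re Q_ζ(g₁) ≤ ε‖g₁‖₂²`.  The twin tests are `T_∓ := g₁(· + L/2) ∓ g₁(· - L/2)`
(`PfPersistenceF5TailTwins.twin (L/2) (±1)`), supported in `[-a, a]`.

* `downCone_twin_le` (DOWN, `T_-`): if `w' = w_ζ` for `log n ≤ 2b`, `w' ≤ w_ζ` for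
  `2b < log n ≤ 2a`, `w_ζ(n₀) - w'(n₀) ≥ δ`, and `ζ` is Weil-positive on the window `a`, then
  `Re Q_{w'}(T_-) ≤ (2ε - δ)·2‖g₁‖₂²`.
* `upCone_twin_le` (UP, `T_+`, which is ONE-SIGNED): if `w_ζ ≤ w'` for `log n ≤ 2a`,
  `w'(n₀) - w_ζ(n₀) ≥ δ` and `ζ` is Weil-positive on the window, the same bound for `T_+`.
* RH-free dichotomy `downCone_negative_or_zeta_not_positive`: `2ε < δ`, `‖g₁‖₂ > 0`
  `⟹ ¬ WeilPositivityOn a ∨ Re Q_{w'}(T_-) < 0` (the up case is the same two lines).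
* `twist_twin_le`: a twist table `f·w_ζ`, `|f| ≤ 1`, `f = 1` for `log n ≤ 2b`, `f(n₀) = -1` (every
  RMF sign corner, `n₀ = p₁` its least flipped prime, WHATEVER the other signs): `δ = 2Λ(n₀)/√n₀`.
* Shape of the killing directions: `T_-(x) = -g₁(x - L/2)` for `x > 0` (`twin_one_apply_of_pos`):
  one-signed on each half-line, and ODD when `g₁` is even (`twin_one_neg_apply`); `T_+` is one-signed.

Proof: `Q_{w'}(T) = Q_ζ(T) + Σ_{n ≤ e^{2a}} (w_ζ(n) - w'(n))(A_T(log n) + A_T(-log n))`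
(`tableDatum_quadratic_eq_add_sum`), `A_T = T ⋆ T̃`; off the central lobe `A_T(±y) = -σ A_{g₁}(±(y - L))`
for `y > 2b` (`autocorr_twin_of_lt`, `autocorr_twin_neg_of_lt`: three of four cross terms die by
support), `A_{g₁} ≥ 0` for one-signed real `g₁`, `A_T(±L) = -σ‖g₁‖₂²` (F5); so every term has a
sign, the `n₀` term is `≤ -2δ‖g₁‖₂²`, and `Re Q_ζ(T) ≤ 4ε‖g₁‖₂²` by the parallelogram law under
window positivity as in F5-A (`re_weilQuadratic_twin_le`).
Readings (FAKES.md §4.5; the numbers there are DATA and are not used here): with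
`ε = ε₁^{ζ,even}(b)` every down-cone corner is negative at the window `log n₀/2 + b` once
`2ε < δ`, or `ζ` is already not window-positive there; the DOWN killing direction is odd /
half-line-one-signed (ODD-sector one-signedness primitives are unsound on the down-cone past onset,
complementing F4-A = `PfPersistenceDownCone`: EVEN one-signed directions never fail there); the UP
killing direction is one-signed (closing fakes for one-signedness leaves must be up-cone, GAP F4-G).
References: A. Weil 1952; E. Bombieri, Rend. Mat. Acc. Lincei (9) 11 (2000) §4; A. Harper, Forum
Math. Pi 8 (2020) e1, arXiv:1703.06654 (the RMF model only).
-/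

set_option linter.dupNamespace false  -- the mandated namespace repeats `RiemannHypothesis`

noncomputable section

open scoped ArithmeticFunction ComplexConjugate
open Set MeasureTheory Complex Literature.NumberTheory.LFunctions
open Summit.RiemannHypothesis.RiemannHypothesis.Theorems.PfPersistenceDownCone
open Summit.RiemannHypothesis.RiemannHypothesis.Theorems.PfPersistenceF5TailTwins (twin twin_eq_add
  isWeilTest_twin tsupport_twin_subset tsupport_add_mul_subset mul_conj_eq_zero_of_shift
  weilConv_weilReflect_twin_two_mul weilConv_weilReflect_twin_neg_two_mul)
open Summit.RiemannHypothesis.RiemannHypothesis.Theorems.PfPersistenceBarrier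
open Summit.RiemannHypothesis.RiemannHypothesis.Theorems.PfPersistenceBarrier.ExplicitDatum

namespace Summit.RiemannHypothesis.RiemannHypothesis.Theorems.PfPersistenceConeTailBound

variable {g : ℝ → ℂ} {b c : ℝ}

/-! ## §1 The autocorrelation of a twin away from the central lobe -/

/-- `T(u) = g(u + c) - σ g(u - c)`. [folklore] -/
theorem twin_apply (c σ : ℝ) (g : ℝ → ℂ) (u : ℝ) : twin c σ g u = g (u + c) - σ * g (u - c) := by
  simp only [twin, PfPersistenceF5TailTwins.translate, sub_neg_eq_add]

/-- Pointwise, for a shift `y > 2b`: `T(u)·conj T(u - y) = -σ·g(u - c)·conj g(u - c - (y - 2c))`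
(`T = twin c σ g`; the other three cross terms vanish by support). [folklore] -/
theorem twin_mul_conj_twin_sub_of_lt (hs : tsupport g ⊆ Icc (-b) b) (hb : 0 < b) (hc : 0 ≤ c)
    (σ : ℝ) {y : ℝ} (hy : 2 * b < y) (u : ℝ) :
    twin c σ g u * conj (twin c σ g (u - y)) =
      -(σ : ℂ) * (g (u - c) * conj (g (u - c - (y - 2 * c)))) := by
  have h1 : g (u + c) * conj (g (u - y + c)) = 0 := mul_conj_eq_zero_of_shift hs
    (by rw [show u + c - (u - y + c) = y by ring, abs_of_pos (by linarith)]; linarith)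
  have h2 : g (u + c) * conj (g (u - y - c)) = 0 := mul_conj_eq_zero_of_shift hs
    (by rw [show u + c - (u - y - c) = y + 2 * c by ring, abs_of_pos (by linarith)]; linarith)
  have h4 : g (u - c) * conj (g (u - y - c)) = 0 := mul_conj_eq_zero_of_shift hs
    (by rw [show u - c - (u - y - c) = y by ring, abs_of_pos (by linarith)]; linarith)
  rw [twin_apply, twin_apply, map_sub, map_mul, Complex.conj_ofReal,
    show u - c - (y - 2 * c) = u - y + c by ring]
  calc (g (u + c) - (σ : ℂ) * g (u - c)) * (conj (g (u - y + c)) - (σ : ℂ) * conj (g (u - y - c)))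
      = g (u + c) * conj (g (u - y + c)) - (σ : ℂ) * (g (u + c) * conj (g (u - y - c)))
          - (σ : ℂ) * (g (u - c) * conj (g (u - y + c)))
          + (σ : ℂ) ^ 2 * (g (u - c) * conj (g (u - y - c))) := by ring
    _ = -(σ : ℂ) * (g (u - c) * conj (g (u - y + c))) := by rw [h1, h2, h4]; ring

/-- Pointwise, mirrored: `T(u)·conj T(u + y) = -σ·g(u + c)·conj g(u + c - (2c - y))` for `y > 2b`. [folklore] -/
theorem twin_mul_conj_twin_add_of_lt (hs : tsupport g ⊆ Icc (-b) b) (hb : 0 < b) (hc : 0 ≤ c)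
    (σ : ℝ) {y : ℝ} (hy : 2 * b < y) (u : ℝ) :
    twin c σ g u * conj (twin c σ g (u + y)) =
      -(σ : ℂ) * (g (u + c) * conj (g (u + c - (2 * c - y)))) := by
  have h1 : g (u + c) * conj (g (u + y + c)) = 0 := mul_conj_eq_zero_of_shift hs
    (by rw [show u + c - (u + y + c) = -y by ring, abs_neg, abs_of_pos (by linarith)]; linarith)
  have h3 : g (u - c) * conj (g (u + y + c)) = 0 := mul_conj_eq_zero_of_shift hs (by
    rw [show u - c - (u + y + c) = -(y + 2 * c) by ring, abs_neg, abs_of_pos (by linarith)]; linarith)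
  have h4 : g (u - c) * conj (g (u + y - c)) = 0 := mul_conj_eq_zero_of_shift hs
    (by rw [show u - c - (u + y - c) = -y by ring, abs_neg, abs_of_pos (by linarith)]; linarith)
  rw [twin_apply, twin_apply, map_sub, map_mul, Complex.conj_ofReal,
    show u + c - (2 * c - y) = u + y - c by ring]
  calc (g (u + c) - (σ : ℂ) * g (u - c)) * (conj (g (u + y + c)) - (σ : ℂ) * conj (g (u + y - c)))
      = g (u + c) * conj (g (u + y + c)) - (σ : ℂ) * (g (u + c) * conj (g (u + y - c)))
          - (σ : ℂ) * (g (u - c) * conj (g (u + y + c)))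
          + (σ : ℂ) ^ 2 * (g (u - c) * conj (g (u + y - c))) := by ring
    _ = -(σ : ℂ) * (g (u + c) * conj (g (u + y - c))) := by rw [h1, h3, h4]; ring

/-- **`A_T(y) = -σ A_g(y - 2c)` for `y > 2b`** (`A = · ⋆ ·̃`; the case `y = 2c` is F5's
`weilConv_weilReflect_twin_two_mul`). [folklore] -/
theorem autocorr_twin_of_lt (hs : tsupport g ⊆ Icc (-b) b) (hb : 0 < b) (hc : 0 ≤ c) (σ : ℝ)
    {y : ℝ} (hy : 2 * b < y) :
    weilConv (twin c σ g) (weilReflect (twin c σ g)) y =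
      -(σ : ℂ) * weilConv g (weilReflect g) (y - 2 * c) := by
  rw [weilConv_apply, weilConv_apply]
  have hpt : (fun u ↦ twin c σ g u * weilReflect (twin c σ g) (y - u)) =
      fun u ↦ -(σ : ℂ) * ((fun s ↦ g s * weilReflect g (y - 2 * c - s)) (u - c)) := by
    funext u
    simp only [weilReflect]
    rw [show -(y - u) = u - y by ring, show -(y - 2 * c - (u - c)) = u - c - (y - 2 * c) by ring]
    exact twin_mul_conj_twin_sub_of_lt hs hb hc σ hy u
  rw [hpt, integral_const_mul, integral_sub_right_eq_self (μ := (volume : Measure ℝ))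
    (fun s : ℝ ↦ g s * weilReflect g (y - 2 * c - s)) c]

/-- **`A_T(-y) = -σ A_g(2c - y)` for `y > 2b`.** [folklore] -/
theorem autocorr_twin_neg_of_lt (hs : tsupport g ⊆ Icc (-b) b) (hb : 0 < b) (hc : 0 ≤ c) (σ : ℝ)
    {y : ℝ} (hy : 2 * b < y) :
    weilConv (twin c σ g) (weilReflect (twin c σ g)) (-y) =
      -(σ : ℂ) * weilConv g (weilReflect g) (2 * c - y) := by
  rw [weilConv_apply, weilConv_apply]
  have hpt : (fun u ↦ twin c σ g u * weilReflect (twin c σ g) (-y - u)) =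
      fun u ↦ -(σ : ℂ) * ((fun s ↦ g s * weilReflect g (2 * c - y - s)) (u + c)) := by
    funext u
    simp only [weilReflect]
    rw [show -(-y - u) = u + y by ring, show -(2 * c - y - (u + c)) = u + c - (2 * c - y) by ring]
    exact twin_mul_conj_twin_add_of_lt hs hb hc σ hy u
  rw [hpt, integral_const_mul, integral_add_right_eq_self (μ := (volume : Measure ℝ))
    (fun s : ℝ ↦ g s * weilReflect g (2 * c - y - s)) c]

/-! ## §2 One-signed real tests: nonnegative autocorrelation; the twins' shape -/

/-- `Re A_f(y) ≥ 0` for a one-signed real test `f` (`f ≥ 0` is the tree's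
`re_weilConv_weilReflect_ofReal_nonneg`). [folklore] -/
theorem re_autocorr_ofReal_nonneg_of_oneSigned {f : ℝ → ℝ} (h1 : (∀ t, 0 ≤ f t) ∨ (∀ t, f t ≤ 0))
    (y : ℝ) : 0 ≤ (weilConv (fun t ↦ (f t : ℂ)) (weilReflect fun t ↦ (f t : ℂ)) y).re := by
  rw [weilConv_weilReflect_ofReal, Complex.ofReal_re]
  refine integral_nonneg fun u ↦ ?_
  rcases h1 with h | h
  · exact mul_nonneg (h u) (h _)
  · calc (0 : ℝ) ≤ (-f u) * (-f (u - y)) := mul_nonneg (neg_nonneg.2 (h u)) (neg_nonneg.2 (h _))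
      _ = f u * f (u - y) := by ring

/-- The up-twin of a real test is the real test `x ↦ f(x + c) + f(x - c)`. [folklore] -/
theorem twin_neg_one_ofReal (f : ℝ → ℝ) (c : ℝ) :
    twin c (-1) (fun t ↦ (f t : ℂ)) = fun t ↦ ((f (t + c) + f (t - c) : ℝ) : ℂ) := by
  funext t
  rw [twin_apply]
  push_cast
  ring

/-- Shape of the down-twin: for `x > 0` (and `b < c`), `T_-(x) = -g(x - c)` — one copy of `-g`
centred at `c`; so `T_-` is one-signed on each half-line. [folklore] -/
theorem twin_one_apply_of_pos (hs : tsupport g ⊆ Icc (-b) b) (hbc : b < c) {x : ℝ} (hx : 0 < x) :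
    twin c 1 g x = -g (x - c) := by
  have hz : g (x + c) = 0 := by
    refine image_eq_zero_of_notMem_tsupport fun h ↦ ?_
    have h' := hs h
    simp only [mem_Icc] at h'
    linarith [h'.2]
  rw [twin_apply, hz]
  push_cast
  ring

/-- … and `T_-` is ODD when `g` is even. [folklore] -/
theorem twin_one_neg_apply (heven : ∀ x, g (-x) = g x) (c x : ℝ) :
    twin c 1 g (-x) = -twin c 1 g x := by
  rw [twin_apply, twin_apply, show -x + c = -(x - c) by ring, show -x - c = -(x + c) by ring,
    heven, heven]
  push_cast
  ring

/-! ## §3 The parallelogram bound for `Re Q_ζ` of a twin (as in F5-A) -/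

/-- `Re Q_ζ(twin c σ g) ≤ 4ε‖g‖₂²` when `σ² ≤ 1`, `Re Q_ζ(g) ≤ ε‖g‖₂²` and `ζ` is Weil-positive on the
window `c + b` (parallelogram law `Re Q(u - σv) + Re Q(u + σv) = 2Re Q(u) + 2σ²Re Q(v)` with
translation invariance of `Q`). [cite: Bombieri2000Weil, §4] -/
theorem re_weilQuadratic_twin_le (hg : IsWeilTest g) (hs : tsupport g ⊆ Icc (-b) b) (hc : 0 ≤ c)
    {σ : ℝ} (hσ : σ ^ 2 ≤ 1) {ε : ℝ}
    (hq : (weilQuadratic g).re ≤ ε * ∫ x, ‖g x‖ ^ 2) (hW : WeilPositivityOn (c + b)) :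
    (weilQuadratic (twin c σ g)).re ≤ 4 * (ε * ∫ x, ‖g x‖ ^ 2) := by
  set u : ℝ → ℂ := PfPersistenceF5TailTwins.translate (-c) g with hu_def
  set v : ℝ → ℂ := PfPersistenceF5TailTwins.translate c g with hv_def
  have hu : IsWeilTest u := PfPersistenceF5TailTwins.isWeilTest_translate hg _
  have hv : IsWeilTest v := PfPersistenceF5TailTwins.isWeilTest_translate hg _
  have hus : tsupport u ⊆ Icc (-(c + b)) (c + b) :=
    (PfPersistenceF5TailTwins.tsupport_translate_subset hs (-c)).trans (Icc_subset_Icc (by linarith) (by linarith))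
  have hvs : tsupport v ⊆ Icc (-(c + b)) (c + b) :=
    (PfPersistenceF5TailTwins.tsupport_translate_subset hs c).trans (Icc_subset_Icc (by linarith) (by linarith))
  have hQu : (weilQuadratic u).re = (weilQuadratic g).re := by
    rw [hu_def, PfPersistenceF5TailTwins.weilQuadratic_translate]
  have hQv : (weilQuadratic v).re = (weilQuadratic g).re := by
    rw [hv_def, PfPersistenceF5TailTwins.weilQuadratic_translate]
  have hQ1 : 0 ≤ (weilQuadratic g).re :=
    hW g hg (hs.trans (Icc_subset_Icc (by linarith) (by linarith)))
  have hplus : 0 ≤ (weilQuadratic (u + fun x ↦ ((σ : ℝ) : ℂ) * v x)).re :=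
    hW _ (hu.add (hv.const_mul _)) (tsupport_add_mul_subset isClosed_Icc hus hvs _)
  rw [twin_eq_add c σ g, ConnesVanSuijlekom.re_weilQuadratic_add_real_mul hu hv (-σ)]
  rw [ConnesVanSuijlekom.re_weilQuadratic_add_real_mul hu hv σ] at hplus
  rw [hQu, hQv] at hplus ⊢
  have h1 : σ ^ 2 * (weilQuadratic g).re ≤ (weilQuadratic g).re := mul_le_of_le_one_left hQ1 hσ
  nlinarith [hσ, hQ1, hq, sq_nonneg σ]

/-! ## §4 Window bookkeeping -/

/-- `A ≤ log(⌊e^{2A}⌋₊ + 1)/2`. [folklore] -/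
theorem le_log_floor_succ_half (A : ℝ) : A ≤ Real.log ((⌊Real.exp (2 * A)⌋₊ : ℝ) + 1) / 2 := by
  have h2 : 2 * A ≤ Real.log ((⌊Real.exp (2 * A)⌋₊ : ℝ) + 1) := by
    rw [Real.le_log_iff_exp_le (by positivity)]
    exact (Nat.lt_floor_add_one _).le
  linarith

/-- `n ≤ ⌊e^{2A}⌋₊ ⟹ log n ≤ 2A` (for `A ≥ 0`). [folklore] -/
theorem log_le_of_mem_range {A : ℝ} (hA : 0 ≤ A) {n : ℕ}
    (hn : n ∈ Finset.range (⌊Real.exp (2 * A)⌋₊ + 1)) : Real.log n ≤ 2 * A := by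
  rcases Nat.eq_zero_or_pos n with h0 | hpos
  · subst h0; simp; linarith
  · have hle : (n : ℝ) ≤ Real.exp (2 * A) :=
      (Nat.cast_le.2 (Nat.lt_succ_iff.1 (Finset.mem_range.1 hn))).trans
        (Nat.floor_le (Real.exp_pos _).le)
    calc Real.log n ≤ Real.log (Real.exp (2 * A)) :=
          Real.log_le_log (by exact_mod_cast hpos) hle
      _ = 2 * A := Real.log_exp _

/-- `0 < log n`, `log n ≤ 2A ⟹ n ≤ ⌊e^{2A}⌋₊`. [folklore] -/
theorem mem_range_of_log_le {A : ℝ} {n : ℕ} (h : Real.log n ≤ 2 * A) (hn0 : 0 < Real.log n) :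
    n ∈ Finset.range (⌊Real.exp (2 * A)⌋₊ + 1) := by
  have hn : n ≠ 0 := by rintro rfl; simp at hn0
  have hnpos : 0 < (n : ℝ) := by exact_mod_cast Nat.pos_of_ne_zero hn
  rw [Finset.mem_range, Nat.lt_succ_iff]
  exact Nat.le_floor ((Real.exp_log hnpos).symm.le.trans (Real.exp_le_exp.2 h))

/-- A finite sum of nonpositive terms is at most any one of its terms' bounds. [folklore] -/
theorem sum_le_of_mem_of_nonpos {s : Finset ℕ} {f : ℕ → ℝ} {i : ℕ} {B : ℝ} (hi : i ∈ s)
    (hf : ∀ n ∈ s, f n ≤ 0) (hB : f i ≤ B) : ∑ n ∈ s, f n ≤ B := by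
  rw [← Finset.add_sum_erase s f hi]
  have : ∑ n ∈ s.erase i, f n ≤ 0 :=
    Finset.sum_nonpos fun n hn ↦ hf n (Finset.mem_of_mem_erase hn)
  linarith

/-! ## §5 THEOREM F4-B±: the cone tail bounds -/

/-- **THEOREM F4-B⁻ (DOWN-cone tail bound), PROVED.**  `w' = w_ζ` on `log n ≤ 2b`, `w' ≤ w_ζ` on
`2b < log n ≤ log n₀ + 2b`, a drop `δ` at `n₀` (`2b < log n₀`), `ζ` Weil-positive on the window
`log n₀/2 + b`, `g₁` real one-signed in `[-b, b]` with `Re Q_ζ(g₁) ≤ ε‖g₁‖₂²`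
`⟹ Re Q_{w'}(g₁(· + log n₀/2) - g₁(· - log n₀/2)) ≤ (2ε - δ)·2‖g₁‖₂²`. [cite: Bombieri2000Weil, §4] -/
theorem downCone_twin_le {w' : ℕ → ℝ} {n₀ : ℕ} {b ε δ : ℝ} (hb : 0 < b)
    (hbL : 2 * b < Real.log n₀)
    (hlow : ∀ n : ℕ, Real.log n ≤ 2 * b → w' n = zetaTable n)
    (hhigh : ∀ n : ℕ, 2 * b < Real.log n → Real.log n ≤ Real.log n₀ + 2 * b → w' n ≤ zetaTable n)
    (hδ : δ ≤ zetaTable n₀ - w' n₀) (hW : WeilPositivityOn (Real.log n₀ / 2 + b))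
    {g₁ : ℝ → ℝ} (h1 : (∀ t, 0 ≤ g₁ t) ∨ (∀ t, g₁ t ≤ 0))
    (hg : IsWeilTest fun t ↦ (g₁ t : ℂ)) (hs : tsupport (fun t ↦ (g₁ t : ℂ)) ⊆ Icc (-b) b)
    (hq : (weilQuadratic fun t ↦ (g₁ t : ℂ)).re ≤ ε * ∫ x, ‖(g₁ x : ℂ)‖ ^ 2) :
    ((tableDatum w').quadratic (twin (Real.log n₀ / 2) 1 fun t ↦ (g₁ t : ℂ))).re ≤
      (2 * ε - δ) * (2 * ∫ x, ‖(g₁ x : ℂ)‖ ^ 2) := by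
  obtain ⟨c, hc_def⟩ : ∃ c : ℝ, c = Real.log n₀ / 2 := ⟨_, rfl⟩
  rw [← hc_def] at hW ⊢
  have hc2 : 2 * c = Real.log n₀ := by rw [hc_def]; ring
  have hbc : b < c := by linarith
  have hc0 : 0 ≤ c := by linarith
  have hQT := re_weilQuadratic_twin_le (σ := 1) hg hs hc0 (by norm_num) hq hW
  obtain ⟨Nm, hN_def⟩ : ∃ Nm : ℝ, Nm = ∫ x, ‖(g₁ x : ℂ)‖ ^ 2 := ⟨_, rfl⟩
  rw [← hN_def] at hQT ⊢
  have hNm : 0 ≤ Nm := by rw [hN_def]; exact integral_nonneg fun x ↦ by positivity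
  have hTw : IsWeilTest (twin c 1 fun t ↦ (g₁ t : ℂ)) := isWeilTest_twin hg c 1
  have hwin := le_log_floor_succ_half (c + b)
  have hTs : tsupport (twin c 1 fun t ↦ (g₁ t : ℂ)) ⊆
      Icc (-(Real.log ((⌊Real.exp (2 * (c + b))⌋₊ : ℝ) + 1) / 2))
        (Real.log ((⌊Real.exp (2 * (c + b))⌋₊ : ℝ) + 1) / 2) :=
    (tsupport_twin_subset hs hc0 1).trans (Icc_subset_Icc (by linarith) hwin)
  have hn0 : n₀ ∈ Finset.range (⌊Real.exp (2 * (c + b))⌋₊ + 1) :=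
    mem_range_of_log_le (by linarith) (by linarith)
  have hA := re_autocorr_ofReal_nonneg_of_oneSigned h1
  rw [tableDatum_quadratic_eq_add_sum zetaTable w' hTw _ hTs, tableDatum_zetaTable_quadratic,
    Complex.add_re, Complex.re_sum]
  refine (add_le_add hQT (sum_le_of_mem_of_nonpos (B := -(2 * δ * Nm)) hn0 ?_ ?_)).trans
    (le_of_eq (by ring))
  · -- every term is ≤ 0
    intro n hn
    rw [Complex.re_ofReal_mul, Complex.add_re]
    by_cases hlo : Real.log n ≤ 2 * b
    · rw [hlow n hlo, sub_self, zero_mul]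
    · push Not at hlo
      have hlog : Real.log n ≤ Real.log n₀ + 2 * b := by
        have := log_le_of_mem_range (by linarith) hn; linarith
      have hw : 0 ≤ zetaTable n - w' n := sub_nonneg.2 (hhigh n hlo hlog)
      rw [autocorr_twin_of_lt hs hb hc0 1 hlo, autocorr_twin_neg_of_lt hs hb hc0 1 hlo]
      have e : ∀ z : ℂ, (-((1 : ℝ) : ℂ) * z).re = -z.re := by intro z; simp
      rw [e, e]
      nlinarith [hA (Real.log n - 2 * c), hA (2 * c - Real.log n)]
  · -- the `n₀` term
    rw [Complex.re_ofReal_mul, Complex.add_re, ← hc2,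
      weilConv_weilReflect_twin_two_mul hs hb hbc 1,
      weilConv_weilReflect_twin_neg_two_mul hs hb hbc 1, ← hN_def]
    have e : (-((1 : ℝ) : ℂ) * (Nm : ℂ)).re = -Nm := by simp
    rw [e]
    nlinarith [hδ, hNm]

/-- **THEOREM F4-B⁺ (UP-cone tail bound), PROVED.**  `w_ζ ≤ w'` on `log n ≤ log n₀ + 2b`, an excess
`δ` at `n₀` (`2b < log n₀`), `ζ` Weil-positive on the window `log n₀/2 + b`, `g₁` real one-signed
in `[-b, b]` with `Re Q_ζ(g₁) ≤ ε‖g₁‖₂²  ⟹  Re Q_{w'}(g₁(· + log n₀/2) + g₁(· - log n₀/2)) ≤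
(2ε - δ)·2‖g₁‖₂²` — a ONE-SIGNED negative direction. [cite: Bombieri2000Weil, §4] -/
theorem upCone_twin_le {w' : ℕ → ℝ} {n₀ : ℕ} {b ε δ : ℝ} (hb : 0 < b)
    (hbL : 2 * b < Real.log n₀)
    (hup : ∀ n : ℕ, Real.log n ≤ Real.log n₀ + 2 * b → zetaTable n ≤ w' n)
    (hδ : δ ≤ w' n₀ - zetaTable n₀) (hW : WeilPositivityOn (Real.log n₀ / 2 + b))
    {g₁ : ℝ → ℝ} (h1 : (∀ t, 0 ≤ g₁ t) ∨ (∀ t, g₁ t ≤ 0))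
    (hg : IsWeilTest fun t ↦ (g₁ t : ℂ)) (hs : tsupport (fun t ↦ (g₁ t : ℂ)) ⊆ Icc (-b) b)
    (hq : (weilQuadratic fun t ↦ (g₁ t : ℂ)).re ≤ ε * ∫ x, ‖(g₁ x : ℂ)‖ ^ 2) :
    ((tableDatum w').quadratic (twin (Real.log n₀ / 2) (-1) fun t ↦ (g₁ t : ℂ))).re ≤
      (2 * ε - δ) * (2 * ∫ x, ‖(g₁ x : ℂ)‖ ^ 2) := by
  obtain ⟨c, hc_def⟩ : ∃ c : ℝ, c = Real.log n₀ / 2 := ⟨_, rfl⟩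
  rw [← hc_def] at hW ⊢
  have hc2 : 2 * c = Real.log n₀ := by rw [hc_def]; ring
  have hbc : b < c := by linarith
  have hc0 : 0 ≤ c := by linarith
  have hQT := re_weilQuadratic_twin_le (σ := -1) hg hs hc0 (by norm_num) hq hW
  obtain ⟨Nm, hN_def⟩ : ∃ Nm : ℝ, Nm = ∫ x, ‖(g₁ x : ℂ)‖ ^ 2 := ⟨_, rfl⟩
  rw [← hN_def] at hQT ⊢
  have hNm : 0 ≤ Nm := by rw [hN_def]; exact integral_nonneg fun x ↦ by positivity
  have hTw : IsWeilTest (twin c (-1) fun t ↦ (g₁ t : ℂ)) := isWeilTest_twin hg c (-1)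
  have hwin := le_log_floor_succ_half (c + b)
  have hTs : tsupport (twin c (-1) fun t ↦ (g₁ t : ℂ)) ⊆
      Icc (-(Real.log ((⌊Real.exp (2 * (c + b))⌋₊ : ℝ) + 1) / 2))
        (Real.log ((⌊Real.exp (2 * (c + b))⌋₊ : ℝ) + 1) / 2) :=
    (tsupport_twin_subset hs hc0 (-1)).trans (Icc_subset_Icc (by linarith) hwin)
  have hn0 : n₀ ∈ Finset.range (⌊Real.exp (2 * (c + b))⌋₊ + 1) :=
    mem_range_of_log_le (by linarith) (by linarith)
  have hA : ∀ y, 0 ≤ (weilConv (twin c (-1) fun t ↦ (g₁ t : ℂ))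
      (weilReflect (twin c (-1) fun t ↦ (g₁ t : ℂ))) y).re := by
    rw [twin_neg_one_ofReal]
    exact re_autocorr_ofReal_nonneg_of_oneSigned
      (h1.imp (fun h t ↦ add_nonneg (h _) (h _)) fun h t ↦ add_nonpos (h _) (h _))
  rw [tableDatum_quadratic_eq_add_sum zetaTable w' hTw _ hTs, tableDatum_zetaTable_quadratic,
    Complex.add_re, Complex.re_sum]
  refine (add_le_add hQT (sum_le_of_mem_of_nonpos (B := -(2 * δ * Nm)) hn0 ?_ ?_)).trans
    (le_of_eq (by ring))
  · intro n hn
    rw [Complex.re_ofReal_mul, Complex.add_re]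
    have hlog : Real.log n ≤ Real.log n₀ + 2 * b := by
      have := log_le_of_mem_range (by linarith) hn; linarith
    have hw : zetaTable n - w' n ≤ 0 := sub_nonpos.2 (hup n hlog)
    nlinarith [hA (Real.log n), hA (-Real.log n)]
  · rw [Complex.re_ofReal_mul, Complex.add_re, ← hc2,
      weilConv_weilReflect_twin_two_mul hs hb hbc (-1),
      weilConv_weilReflect_twin_neg_two_mul hs hb hbc (-1), ← hN_def]
    have e : (-((-1 : ℝ) : ℂ) * (Nm : ℂ)).re = Nm := by simp
    rw [e]
    nlinarith [hδ, hNm]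

/-! ## §6 Corollaries: RH-free dichotomies; twist (RMF) corners -/

/-- **Down-cone dichotomy (RH-free).** `2ε < δ`, `‖g₁‖₂ > 0`: either `ζ` is not Weil-positive on the
window `log n₀/2 + b`, or the down-twin is a negative direction of `Q_{w'}` there. [cite: Bombieri2000Weil, §4] -/
theorem downCone_negative_or_zeta_not_positive {w' : ℕ → ℝ} {n₀ : ℕ} {b ε δ : ℝ} (hb : 0 < b)
    (hbL : 2 * b < Real.log n₀)
    (hlow : ∀ n : ℕ, Real.log n ≤ 2 * b → w' n = zetaTable n)
    (hhigh : ∀ n : ℕ, 2 * b < Real.log n → Real.log n ≤ Real.log n₀ + 2 * b → w' n ≤ zetaTable n)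
    (hδ : δ ≤ zetaTable n₀ - w' n₀)
    {g₁ : ℝ → ℝ} (h1 : (∀ t, 0 ≤ g₁ t) ∨ (∀ t, g₁ t ≤ 0))
    (hg : IsWeilTest fun t ↦ (g₁ t : ℂ)) (hs : tsupport (fun t ↦ (g₁ t : ℂ)) ⊆ Icc (-b) b)
    (hq : (weilQuadratic fun t ↦ (g₁ t : ℂ)).re ≤ ε * ∫ x, ‖(g₁ x : ℂ)‖ ^ 2)
    (hpos : 0 < ∫ x, ‖(g₁ x : ℂ)‖ ^ 2) (hε : 2 * ε < δ) :
    ¬ WeilPositivityOn (Real.log n₀ / 2 + b) ∨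
      ((tableDatum w').quadratic (twin (Real.log n₀ / 2) 1 fun t ↦ (g₁ t : ℂ))).re < 0 := by
  by_cases hW : WeilPositivityOn (Real.log n₀ / 2 + b)
  · exact Or.inr (lt_of_le_of_lt (downCone_twin_le hb hbL hlow hhigh hδ hW h1 hg hs hq)
      (mul_neg_of_neg_of_pos (by linarith) (by linarith)))
  · exact Or.inl hW

/-- **Twist / RMF sign corners.** `|f| ≤ 1`, `f(n) = 1` for `log n ≤ 2b`, `f(n₀) = -1`, `2b < log n₀`
(an RMF sign pattern with least flipped prime `n₀ = p₁`, whatever the other signs), `ζ`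
Weil-positive on the window: `Re Q_{f·w_ζ}(T_-) ≤ (2ε - 2Λ(n₀)/√n₀)·2‖g₁‖₂²`. [cite: Bombieri2000Weil, §4] -/
theorem twist_twin_le {f : ℕ → ℝ} {n₀ : ℕ} {b ε : ℝ} (hb : 0 < b) (hbL : 2 * b < Real.log n₀)
    (hf1 : ∀ n, |f n| ≤ 1) (hlow : ∀ n : ℕ, Real.log n ≤ 2 * b → f n = 1) (hf0 : f n₀ = -1)
    (hW : WeilPositivityOn (Real.log n₀ / 2 + b))
    {g₁ : ℝ → ℝ} (h1 : (∀ t, 0 ≤ g₁ t) ∨ (∀ t, g₁ t ≤ 0))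
    (hg : IsWeilTest fun t ↦ (g₁ t : ℂ)) (hs : tsupport (fun t ↦ (g₁ t : ℂ)) ⊆ Icc (-b) b)
    (hq : (weilQuadratic fun t ↦ (g₁ t : ℂ)).re ≤ ε * ∫ x, ‖(g₁ x : ℂ)‖ ^ 2) :
    ((tableDatum (twistTable f)).quadratic (twin (Real.log n₀ / 2) 1 fun t ↦ (g₁ t : ℂ))).re ≤
      (2 * ε - 2 * zetaTable n₀) * (2 * ∫ x, ‖(g₁ x : ℂ)‖ ^ 2) :=
  downCone_twin_le hb hbL (fun n hn ↦ by simp [twistTable, hlow n hn])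
    (fun n _ _ ↦ twistTable_le_zetaTable_of_abs hf1 n)
    (by simp only [twistTable, hf0]; linarith) hW h1 hg hs hq

end Summit.RiemannHypothesis.RiemannHypothesis.Theorems.PfPersistenceConeTailBound

end
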